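import Mathlib
import HarnessLib

/-!
# Low-order Gauss, Radau and Lobatto rules on `[-1, 1]` in closed form (Davis–Rabinowitz 1984, Sect. 2.7, 2.7.1)

Davis–Rabinowitz, *Methods of Numerical Integration* (2nd ed., 1984): Sect. 2.7, the Gauss rule `G_n` for
`w ≡ 1` on `[-1, 1]` is exact on `𝒫_{2n-1}` (2.7.7) with error
`E_n(f) = 2^{2n+1}(n!)^4 / ((2n+1)[(2n)!]^3) f^{(2n)}(ξ)`
(2.7.11); Sect. 2.7.1, Radau integration `∫_{-1}^{1} f = (2/n²) f(-1) + Σ w_j f(x_j) + E`,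
`E = 2^{2n-1} n [(n-1)!]^4 / [(2n-1)!]^3 f^{(2n-1)}(ξ)` (2.7.1.7)–(2.7.1.10), and Lobatto integration
`∫_{-1}^{1} f = 2/(n(n-1)) [f(1) + f(-1)] + Σ w_j f(x_j) + E`,
`E = -n(n-1)^3 2^{2n-1} [(n-2)!]^4 / ((2n-1)[(2n-2)!]^3) f^{(2n-2)}(ξ)` (2.7.1.11)–(2.7.1.13).

Recorded (self-contained, coefficientwise): the closed forms of the smallest members — `G₂` (nodes `±u`,
`u² = 1/3`, weights `1, 1`), `G₃` (nodes `0, ±v`, `v² = 3/5`, weights `8/9, 5/9, 5/9`), the left Radau rule `R₂`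
(nodes `-1, 1/3`, weights `1/2, 3/2`) and the Lobatto rule `L₄` (nodes `±1, ±u`, `u² = 1/5`, weights `1/6, 5/6`) —
with their polynomial exactness (degrees `3, 5, 2, 5`) and the error constants of (2.7.11), (2.7.1.10), (2.7.1.13)
evaluated at `n = 2, 3`, `n = 2`, `n = 4` (`1/135`, `1/15750`, `2/27`, `-2/23625`) and *pinned on the first non-exact
degree*.  The irrational nodes enter only through `u² = 1/3`, `v² = 3/5`, `u² = 1/5`, so the statements hold for
either sign choice.  The general theory (`gaussLegendreNodes/Weight`, exactness `< 2n`, the error theorem with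
`gaussLegendreErrorConst`) is the tree's `GaussLegendreQuadrature`/`GaussLegendreQuadratureError`; identification
of these closed forms with `gaussLegendreNodes 2, 3` is not restated here.

Provenance: engines group, shared numerical engines serving client cells; rigour lives in the verifiers; every
published number belongs to a client cell's ledger, not to the engines group.  Textbook facts only (no client
numbers).
-/

namespace Literature.Analysis.Quadrature

open Set MeasureTheory intervalIntegral Finset Polynomial
open scoped Real Interval

noncomputable section

/-- [folklore] `∫_a^b p = Σ_{i<n} c_i (b^{i+1} - a^{i+1})/(i+1)` for `deg p < n`. -/
private theorem integral_eval_eq_sum₃ (p : ℝ[X]) {n : ℕ} (hn : p.natDegree < n) (a b : ℝ) :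
    ∫ x in a..b, p.eval x = ∑ i ∈ range n, p.coeff i * ((b ^ (i + 1) - a ^ (i + 1)) / (i + 1)) := by
  simp_rw [eval_eq_sum_range' hn]
  rw [intervalIntegral.integral_finsetSum fun i _ => ?_]
  · refine Finset.sum_congr rfl fun i _ => ?_
    rw [intervalIntegral.integral_const_mul, integral_pow]
  · exact (continuous_const.mul (continuous_pow i)).intervalIntegrable _ _

/-! ### The error constants (2.7.11), (2.7.1.10), (2.7.1.13) as functions of `n` -/

/-- `e_G(n) = 2^{2n+1}(n!)^4 / ((2n+1)[(2n)!]^3)`. [cite: DavisRabinowitz1984, Sect. 2.7 (2.7.11)] -/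
def gaussErrorCoeff (n : ℕ) : ℝ :=
  2 ^ (2 * n + 1) * (n.factorial : ℝ) ^ 4 / ((2 * n + 1) * ((2 * n).factorial : ℝ) ^ 3)

/-- `e_R(n) = 2^{2n-1} n [(n-1)!]^4 / [(2n-1)!]^3`. [cite: DavisRabinowitz1984, Sect. 2.7.1 (2.7.1.10)] -/
def radauErrorCoeff (n : ℕ) : ℝ :=
  2 ^ (2 * n - 1) * n * ((n - 1).factorial : ℝ) ^ 4 / ((2 * n - 1).factorial : ℝ) ^ 3

/-- `e_L(n) = -n(n-1)^3 2^{2n-1} [(n-2)!]^4 / ((2n-1)[(2n-2)!]^3)`.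
[cite: DavisRabinowitz1984, Sect. 2.7.1 (2.7.1.13)] -/
def lobattoErrorCoeff (n : ℕ) : ℝ :=
  -(n * ((n : ℝ) - 1) ^ 3 * 2 ^ (2 * n - 1) * ((n - 2).factorial : ℝ) ^ 4) /
    ((2 * n - 1) * ((2 * n - 2).factorial : ℝ) ^ 3)

/-- `e_G(1) = 1/3`, `e_G(2) = 1/135`, `e_G(3) = 1/15750`. [cite: DavisRabinowitz1984, Sect. 2.7 (2.7.11)] -/
theorem gaussErrorCoeff_values :
    gaussErrorCoeff 1 = 1 / 3 ∧ gaussErrorCoeff 2 = 1 / 135 ∧ gaussErrorCoeff 3 = 1 / 15750 := by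
  refine ⟨?_, ?_, ?_⟩ <;> norm_num [gaussErrorCoeff, Nat.factorial]

/-- `e_R(2) = 2/27`, `e_R(3) = 1/1125`. [cite: DavisRabinowitz1984, Sect. 2.7.1 (2.7.1.10)] -/
theorem radauErrorCoeff_values : radauErrorCoeff 2 = 2 / 27 ∧ radauErrorCoeff 3 = 1 / 1125 := by
  refine ⟨?_, ?_⟩ <;> norm_num [radauErrorCoeff, Nat.factorial]

/-- `e_L(3) = -1/90` (Simpson), `e_L(4) = -2/23625`. [cite: DavisRabinowitz1984, Sect. 2.7.1 (2.7.1.13)] -/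
theorem lobattoErrorCoeff_values : lobattoErrorCoeff 3 = -(1 / 90) ∧ lobattoErrorCoeff 4 = -(2 / 23625) := by
  refine ⟨?_, ?_⟩ <;> norm_num [lobattoErrorCoeff, Nat.factorial]

/-! ### `G₂`: nodes `±u`, `u² = 1/3`, weights `1, 1` -/

/-- The two-point Gauss rule with node parameter `u` (`u² = 1/3`). [cite: DavisRabinowitz1984, Sect. 2.7 (2.7.7)] -/
def gaussLegendreTwo (u : ℝ) (f : ℝ → ℝ) : ℝ := f (-u) + f u

/-- `G₂` is exact on cubics. [cite: DavisRabinowitz1984, Sect. 2.7 (2.7.7)] -/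
theorem integral_eq_gaussLegendreTwo {u : ℝ} (hu : u ^ 2 = 1 / 3) (p : ℝ[X]) (hp : p.natDegree ≤ 3) :
    ∫ x in (-1 : ℝ)..1, p.eval x = gaussLegendreTwo u (fun x => p.eval x) := by
  have hn : p.natDegree < 4 := by omega
  rw [integral_eval_eq_sum₃ p hn, gaussLegendreTwo]
  simp only [eval_eq_sum_range' hn, Finset.sum_range_succ, Finset.sum_range_zero]
  push_cast
  linear_combination (-2 * p.coeff 2) * hu

/-- `G₂` on quartics: `∫ p - G₂ p = e_G(2) · p⁽⁴⁾ = (1/135) · 24 c₄`.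
[cite: DavisRabinowitz1984, Sect. 2.7 (2.7.11)] -/
theorem integral_sub_gaussLegendreTwo {u : ℝ} (hu : u ^ 2 = 1 / 3) (p : ℝ[X]) (hp : p.natDegree ≤ 4) :
    (∫ x in (-1 : ℝ)..1, p.eval x) - gaussLegendreTwo u (fun x => p.eval x) = 1 / 135 * (24 * p.coeff 4) := by
  have hn : p.natDegree < 5 := by omega
  rw [integral_eval_eq_sum₃ p hn, gaussLegendreTwo]
  simp only [eval_eq_sum_range' hn, Finset.sum_range_succ, Finset.sum_range_zero]
  push_cast
  linear_combination (-2 * p.coeff 2 - 2 * p.coeff 4 * (u ^ 2 + 1 / 3)) * hu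

/-! ### `G₃`: nodes `0, ±v`, `v² = 3/5`, weights `8/9, 5/9, 5/9` -/

/-- The three-point Gauss rule with node parameter `v` (`v² = 3/5`). [cite: DavisRabinowitz1984, Sect. 2.7 (2.7.7)] -/
def gaussLegendreThree (v : ℝ) (f : ℝ → ℝ) : ℝ := 8 / 9 * f 0 + 5 / 9 * (f (-v) + f v)

/-- `G₃` is exact on quintics. [cite: DavisRabinowitz1984, Sect. 2.7 (2.7.7)] -/
theorem integral_eq_gaussLegendreThree {v : ℝ} (hv : v ^ 2 = 3 / 5) (p : ℝ[X]) (hp : p.natDegree ≤ 5) :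
    ∫ x in (-1 : ℝ)..1, p.eval x = gaussLegendreThree v (fun x => p.eval x) := by
  have hn : p.natDegree < 6 := by omega
  rw [integral_eval_eq_sum₃ p hn, gaussLegendreThree]
  simp only [eval_eq_sum_range' hn, Finset.sum_range_succ, Finset.sum_range_zero]
  push_cast
  linear_combination (-(10 / 9) * p.coeff 2 - 10 / 9 * p.coeff 4 * (v ^ 2 + 3 / 5)) * hv

/-- `G₃` on sextics: `∫ p - G₃ p = e_G(3) · p⁽⁶⁾ = (1/15750) · 720 c₆`.
[cite: DavisRabinowitz1984, Sect. 2.7 (2.7.11)] -/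
theorem integral_sub_gaussLegendreThree {v : ℝ} (hv : v ^ 2 = 3 / 5) (p : ℝ[X]) (hp : p.natDegree ≤ 6) :
    (∫ x in (-1 : ℝ)..1, p.eval x) - gaussLegendreThree v (fun x => p.eval x) = 1 / 15750 * (720 * p.coeff 6) := by
  have hn : p.natDegree < 7 := by omega
  rw [integral_eval_eq_sum₃ p hn, gaussLegendreThree]
  simp only [eval_eq_sum_range' hn, Finset.sum_range_succ, Finset.sum_range_zero]
  push_cast
  linear_combination (-(10 / 9) * p.coeff 2 - 10 / 9 * p.coeff 4 * (v ^ 2 + 3 / 5)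
    - 10 / 9 * p.coeff 6 * (v ^ 4 + 3 / 5 * v ^ 2 + 9 / 25)) * hv

/-! ### `R₂` (left Radau): nodes `-1, 1/3`, weights `1/2, 3/2` -/

/-- The two-point left Radau rule. [cite: DavisRabinowitz1984, Sect. 2.7.1 (2.7.1.7)] -/
def radauTwo (f : ℝ → ℝ) : ℝ := 1 / 2 * f (-1) + 3 / 2 * f (1 / 3)

/-- `R₂` is exact on quadratics (`2n - 2 = 2`). [cite: DavisRabinowitz1984, Sect. 2.7.1 (2.7.1.7)] -/
theorem integral_eq_radauTwo (p : ℝ[X]) (hp : p.natDegree ≤ 2) :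
    ∫ x in (-1 : ℝ)..1, p.eval x = radauTwo fun x => p.eval x := by
  have hn : p.natDegree < 3 := by omega
  rw [integral_eval_eq_sum₃ p hn, radauTwo]
  simp only [eval_eq_sum_range' hn, Finset.sum_range_succ, Finset.sum_range_zero]
  push_cast
  ring

/-- `R₂` on cubics: `∫ p - R₂ p = e_R(2) · p''' = (2/27) · 6 c₃`.
[cite: DavisRabinowitz1984, Sect. 2.7.1 (2.7.1.10)] -/
theorem integral_sub_radauTwo (p : ℝ[X]) (hp : p.natDegree ≤ 3) :
    (∫ x in (-1 : ℝ)..1, p.eval x) - radauTwo (fun x => p.eval x) = 2 / 27 * (6 * p.coeff 3) := by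
  have hn : p.natDegree < 4 := by omega
  rw [integral_eval_eq_sum₃ p hn, radauTwo]
  simp only [eval_eq_sum_range' hn, Finset.sum_range_succ, Finset.sum_range_zero]
  push_cast
  ring

/-! ### `L₄` (Lobatto): nodes `±1, ±u`, `u² = 1/5`, weights `1/6, 1/6, 5/6, 5/6` -/

/-- The four-point Lobatto rule with inner-node parameter `u` (`u² = 1/5`).
[cite: DavisRabinowitz1984, Sect. 2.7.1 (2.7.1.11)-(2.7.1.12)] -/
def lobattoFour (u : ℝ) (f : ℝ → ℝ) : ℝ := 1 / 6 * (f (-1) + f 1) + 5 / 6 * (f (-u) + f u)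

/-- `L₄` is exact on quintics (`2n - 3 = 5`). [cite: DavisRabinowitz1984, Sect. 2.7.1 (2.7.1.11)] -/
theorem integral_eq_lobattoFour {u : ℝ} (hu : u ^ 2 = 1 / 5) (p : ℝ[X]) (hp : p.natDegree ≤ 5) :
    ∫ x in (-1 : ℝ)..1, p.eval x = lobattoFour u (fun x => p.eval x) := by
  have hn : p.natDegree < 6 := by omega
  rw [integral_eval_eq_sum₃ p hn, lobattoFour]
  simp only [eval_eq_sum_range' hn, Finset.sum_range_succ, Finset.sum_range_zero]
  push_cast
  linear_combination (-(5 / 3) * p.coeff 2 - 5 / 3 * p.coeff 4 * (u ^ 2 + 1 / 5)) * hu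

/-- `L₄` on sextics: `∫ p - L₄ p = e_L(4) · p⁽⁶⁾ = -(2/23625) · 720 c₆`.
[cite: DavisRabinowitz1984, Sect. 2.7.1 (2.7.1.13)] -/
theorem integral_sub_lobattoFour {u : ℝ} (hu : u ^ 2 = 1 / 5) (p : ℝ[X]) (hp : p.natDegree ≤ 6) :
    (∫ x in (-1 : ℝ)..1, p.eval x) - lobattoFour u (fun x => p.eval x) = -(2 / 23625) * (720 * p.coeff 6) := by
  have hn : p.natDegree < 7 := by omega
  rw [integral_eval_eq_sum₃ p hn, lobattoFour]
  simp only [eval_eq_sum_range' hn, Finset.sum_range_succ, Finset.sum_range_zero]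
  push_cast
  linear_combination (-(5 / 3) * p.coeff 2 - 5 / 3 * p.coeff 4 * (u ^ 2 + 1 / 5)
    - 5 / 3 * p.coeff 6 * (u ^ 4 + 1 / 5 * u ^ 2 + 1 / 25)) * hu

/-- The node parameters exist: `(√3/3)² = 1/3`, `(√15/5)² = 3/5`, `(√5/5)² = 1/5` (nodes of `G₂`, `G₃`, `L₄`).
[cite: DavisRabinowitz1984, Sect. 2.7 (2.7.7), Sect. 2.7.1 (2.7.1.11)] -/
theorem node_param_sq :
    (Real.sqrt 3 / 3) ^ 2 = 1 / 3 ∧ (Real.sqrt 15 / 5) ^ 2 = 3 / 5 ∧ (Real.sqrt 5 / 5) ^ 2 = 1 / 5 := by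
  refine ⟨?_, ?_, ?_⟩
  · rw [div_pow, Real.sq_sqrt (by norm_num)]; norm_num
  · rw [div_pow, Real.sq_sqrt (by norm_num)]; norm_num
  · rw [div_pow, Real.sq_sqrt (by norm_num)]; norm_num

end

end Literature.Analysis.Quadrature
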